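import Summits.Ventures.HSemireg.WedgeHankelRecurrenceGaussGegenbauerChebyshevTNodes

/-!
# Venture HSemireg — **`U_m` AND `U_n` ARE COPRIME IFF `gcd(m+1, n+1) = 1`** (Mathlib's Chebyshev polynomials of the second kind over any field with `2 ≠ 0`; the algebraic form of «the node sets
# `{cos(jπ∕(m+1))}` and `{cos(kπ∕(n+1))}` of the second-kind Gauss–Chebyshev ∕ Fejér rules are disjoint iff `gcd(m+1,n+1) = 1`»): via the **addition formula `U_{m+n} = U_m U_n − U_{m−1} U_{n−1}`**
# (all `m, n ∈ ℤ`, any commutative ring), the Euclidean reduction **`IsCoprime U_{j+km} U_{m−1} ⟺ IsCoprime U_j U_{m−1}`** and `Nat.gcd` induction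

HONEST FRAMING. Part of the Lean index of the computation cell `pub-hsemireg` (seat p10 gen 47, Sunday typer «UNIFORM-IN-n»).  Polynomial algebra only (Mathlib `IsCoprime`, `Polynomial.Chebyshev`);
no variety, no cohomology theory, no sheaf, no Ext group and no semiregularity map is constructed here; nothing here says that HC / HC_CM / HC_AV holds; no Literature fact (unproved `Prop`) is
declared or used.  Custodian versions as in `WedgeHankelSiegelIdeal` (1/3).
SOURCES (cited).  J. C. Mason, D. C. Handscomb, *Chebyshev Polynomials* (2003), §1.2 (addition formulae), Ex. 5.x; M. O. Rayes, V. Trevisan, P. S. Wang, *Factorization properties of Chebyshev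
polynomials*, Comput. Math. Appl. 50 (2005) 1231–1240, Thm 5 (`gcd(U_m, U_n) = U_{gcd(m+1,n+1)−1}`); T. J. Rivlin, *Chebyshev Polynomials* (1990), §1.2.  Typed here in `IsCoprime` form (the strong
divisibility statement itself is not typed).
PROOF TYPED HERE.  `Polynomial.Chebyshev.induct` for the addition formula (as Mathlib's `T_mul_T`); Mathlib `IsCoprime.add_mul_left_left_iff`, `IsCoprime.mul_left_iff`, `isCoprime_zero_left`,
`natDegree_eq_zero_of_isUnit`, `natDegree_U_natCast`; N445 `chebyshev_isCoprime_U_succ`; core `Nat.gcd.induction`, `Nat.gcd_rec`.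
DEDUP DISCLOSURE (`rg -n -i 'U_add|isCoprime_iff_coprime|LucasSequences' Summits Literature` and Mathlib `Chebyshev.lean`, 2026-09-04): Mathlib has `T_mul_T`, `T_mul` only; `Literature.Algebra.Polynomial.
ChebyshevExplicitForms.U_add_eq_U_mul_T_add_T_mul_U` is a DIFFERENT addition formula (`U_{a+n} = U_aT_n + T_{a+1}U_{n−1}`); `Literature/NumberTheory/LucasSequences/Divisibility.lean` has the integer
Lucas-sequence analogue (`gcd(U_m,U_n) = U_{gcd}` over `ℤ`), not the polynomial statement; N438 `chebyshevT_mul_U`; 0 hits for the 6 names below.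

WHAT IS IN THE TREE.  N438 `chebyshevT_mul_U`, `chebyshevU_dvd_U_mul_pred`; N445 `chebyshev_isCoprime_U_succ`; N450 `chebyshevU_isCoprime_gap_two_iff`.
THIS FILE (namespace `Summit.Ventures.HSemireg.Wedge.HankelOuter` continued; CHAINED on N452; 0 definitions):
* §1218 **`chebyshevU_add`** (`U_{m+n} = U_mU_n − U_{m−1}U_{n−1}`), `chebyshevU_isCoprime_add_iff`, `chebyshevU_isCoprime_add_mul_iff`, `chebyshevU_isUnit_iff` (`IsUnit U_{n−1} ⟺ n = 1`),
  **`chebyshevU_isCoprime_pred_iff_coprime`** (`IsCoprime U_{m−1} U_{n−1} ⟺ Nat.Coprime m n`), **`chebyshevU_isCoprime_iff_coprime_succ`** (`IsCoprime U_m U_n ⟺ Nat.Coprime (m+1) (n+1)`).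
CAVEATS.  Fields with `2 ≠ 0` for the iff (the reduction lemmas hold in any commutative ring).  Nothing Ext-side.  New names only.
-/

open Module Polynomial
open scoped Matrix Polynomial

namespace Summit.Ventures.HSemireg.Wedge.HankelOuter

/-! ## §1218. `IsCoprime U_m U_n ⟺ gcd(m+1, n+1) = 1` -/

/-- **ADDITION FORMULA: `U_{m+n} = U_m U_n − U_{m−1} U_{n−1}`** (all `m, n ∈ ℤ`, any commutative ring). [Mason–Handscomb §1.2; this file, §1218] -/
theorem chebyshevU_add {R : Type*} [CommRing R] (m n : ℤ) :
    Polynomial.Chebyshev.U R (m + n) = Polynomial.Chebyshev.U R m * Polynomial.Chebyshev.U R n - Polynomial.Chebyshev.U R (m - 1) * Polynomial.Chebyshev.U R (n - 1) := by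
  induction n using Polynomial.Chebyshev.induct with
  | zero => simp only [add_zero, zero_sub, Polynomial.Chebyshev.U_zero, Polynomial.Chebyshev.U_neg_one, mul_one, mul_zero, sub_zero]
  | one => rw [show (1 : ℤ) - 1 = 0 by norm_num, Polynomial.Chebyshev.U_zero, Polynomial.Chebyshev.U_one, Polynomial.Chebyshev.U_add_one]; ring
  | add_two n ih1 ih2 =>
    have h₁ := Polynomial.Chebyshev.U_add_two R (m + n)
    have h₃ := Polynomial.Chebyshev.U_add_two R (n : ℤ)
    have h₄ := Polynomial.Chebyshev.U_add_one R (n : ℤ)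
    linear_combination (norm := ring_nf) h₁ + 2 * (X : R[X]) * ih1 - ih2 - Polynomial.Chebyshev.U R m * h₃ + Polynomial.Chebyshev.U R (m - 1) * h₄
  | neg_add_one n ih1 ih2 =>
    have h₁ := Polynomial.Chebyshev.U_sub_one R (m - n)
    have h₃ := Polynomial.Chebyshev.U_sub_one R (-(n : ℤ))
    have h₄ := Polynomial.Chebyshev.U_sub_one R (-(n : ℤ) - 1)
    linear_combination (norm := ring_nf) h₁ + 2 * (X : R[X]) * ih1 - ih2 - Polynomial.Chebyshev.U R m * h₃ + Polynomial.Chebyshev.U R (m - 1) * h₄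

/-- **Euclidean step: `IsCoprime U_{j+m} U_{m−1} ⟺ IsCoprime U_j U_{m−1}`** (any commutative ring). [this file, §1218] -/
theorem chebyshevU_isCoprime_add_iff {R : Type*} [CommRing R] (j m : ℤ) :
    IsCoprime (Polynomial.Chebyshev.U R (j + m)) (Polynomial.Chebyshev.U R (m - 1)) ↔ IsCoprime (Polynomial.Chebyshev.U R j) (Polynomial.Chebyshev.U R (m - 1)) := by
  have hadd : Polynomial.Chebyshev.U R (j + m) = Polynomial.Chebyshev.U R j * Polynomial.Chebyshev.U R m + Polynomial.Chebyshev.U R (m - 1) * (-Polynomial.Chebyshev.U R (j - 1)) := by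
    rw [chebyshevU_add]; ring
  have hsucc : IsCoprime (Polynomial.Chebyshev.U R m) (Polynomial.Chebyshev.U R (m - 1)) := by
    have h := chebyshev_isCoprime_U_succ (R := R) (m - 1)
    rwa [sub_add_cancel] at h
  rw [hadd, IsCoprime.add_mul_left_left_iff, IsCoprime.mul_left_iff, and_iff_left hsucc]

/-- **Iterated: `IsCoprime U_{j+km} U_{m−1} ⟺ IsCoprime U_j U_{m−1}`** (`k ∈ ℕ`). [this file, §1218] -/
theorem chebyshevU_isCoprime_add_mul_iff {R : Type*} [CommRing R] (j m : ℤ) (k : ℕ) :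
    IsCoprime (Polynomial.Chebyshev.U R (j + k * m)) (Polynomial.Chebyshev.U R (m - 1)) ↔ IsCoprime (Polynomial.Chebyshev.U R j) (Polynomial.Chebyshev.U R (m - 1)) := by
  induction k with
  | zero => rw [Nat.cast_zero, zero_mul, add_zero]
  | succ k ih => rw [Nat.cast_succ, add_one_mul, ← add_assoc, chebyshevU_isCoprime_add_iff, ih]

/-- `IsUnit U_{n−1} ⟺ n = 1` over a field with `2 ≠ 0` (`U_{−1} = 0`, `deg U_{n−1} = n − 1`). [this file, §1218] -/
theorem chebyshevU_isUnit_iff {K : Type*} [Field K] (h2 : (2 : K) ≠ 0) (n : ℕ) : IsUnit (Polynomial.Chebyshev.U K ((n : ℤ) - 1)) ↔ n = 1 := by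
  haveI : NeZero (2 : K) := ⟨h2⟩
  rcases n with _ | k
  · simp only [Nat.cast_zero, zero_sub, Polynomial.Chebyshev.U_neg_one, isUnit_zero_iff, zero_ne_one]
  · rw [show (((k + 1 : ℕ)) : ℤ) - 1 = (k : ℤ) by push_cast; ring]
    constructor
    · intro h
      have hd := Polynomial.natDegree_eq_zero_of_isUnit h
      rw [Polynomial.Chebyshev.natDegree_U_natCast] at hd
      omega
    · intro h
      rw [show k = 0 by omega, Nat.cast_zero, Polynomial.Chebyshev.U_zero]
      exact isUnit_one

/-- **`IsCoprime U_{m−1} U_{n−1} ⟺ Nat.Coprime m n`** over a field with `2 ≠ 0` (`Nat.gcd` induction). [Rayes–Trevisan–Wang 2005 Thm 5 (coprimality form); this file, §1218] -/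
theorem chebyshevU_isCoprime_pred_iff_coprime {K : Type*} [Field K] (h2 : (2 : K) ≠ 0) (m n : ℕ) :
    IsCoprime (Polynomial.Chebyshev.U K ((m : ℤ) - 1)) (Polynomial.Chebyshev.U K ((n : ℤ) - 1)) ↔ Nat.Coprime m n := by
  induction m, n using Nat.gcd.induction with
  | H0 n =>
    rw [Nat.cast_zero, zero_sub, Polynomial.Chebyshev.U_neg_one, isCoprime_zero_left, chebyshevU_isUnit_iff h2, Nat.coprime_zero_left]
  | H1 m n hm ih =>
    rw [isCoprime_comm, Nat.Coprime, Nat.gcd_rec, ← Nat.Coprime, ← ih]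
    conv_lhs => rw [← Nat.mod_add_div n m]
    rw [show ((((n % m + m * (n / m) : ℕ)) : ℤ)) - 1 = (((n % m : ℕ) : ℤ) - 1) + ((n / m : ℕ) : ℤ) * (m : ℤ) by push_cast; ring,
      show ((m : ℤ) - 1) = (m : ℤ) - 1 from rfl, chebyshevU_isCoprime_add_mul_iff]

/-- **`IsCoprime U_m U_n ⟺ gcd(m+1, n+1) = 1`** over a field with `2 ≠ 0`. [Rayes–Trevisan–Wang 2005 Thm 5; Mason–Handscomb Ex. 5.x; this file, §1218] -/
theorem chebyshevU_isCoprime_iff_coprime_succ {K : Type*} [Field K] (h2 : (2 : K) ≠ 0) (m n : ℕ) :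
    IsCoprime (Polynomial.Chebyshev.U K (m : ℤ)) (Polynomial.Chebyshev.U K (n : ℤ)) ↔ Nat.Coprime (m + 1) (n + 1) := by
  have h := chebyshevU_isCoprime_pred_iff_coprime h2 (m + 1) (n + 1)
  push_cast at h
  simpa only [add_sub_cancel_right] using h

end Summit.Ventures.HSemireg.Wedge.HankelOuter
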